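import Summits.CriticalPhenomena.CardyFormulaZ2.Theorems.CardyIKTransportIKMixedBoxCrossingDefectDefs
import Literature.Probability.Percolation.NonBacktrackingPathCounting

-- the stub lives in the skeleton's namespace `…Cruxes.IKMixedBoxCrossing.DefectClosureExploration`, not the file path's
set_option linter.dupNamespace false

/-!
# Stub `stub_polymerTail` of the line `defect-closure-exploration` (crux `IKMixedBoxCrossing`,
stmt-CriticalPhenomena-5911): mask polymers are subcritical, `maskTail ρ V f r ≤ (7ρ)^r`

`maskTail ρ V f r` is the Bernoulli(`ρ`)-on-`V` probability that the king-connected cluster of the face `f` inside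
the random mask `D ⊆ V` reaches sup-distance `≥ r` from `f`.  We prove `PolymerTail`:
`maskTail ρ V f r ≤ (7ρ)^r` for all `0 ≤ ρ ≤ 1`, `V`, `f`, `r`.  No new definitions: king steps are coded by the
Literature alphabet `Fin 4 × Bool` of `nbwWords` (direction `E = (1,0)`, `NE = (1,1)`, `N = (0,1)`, `NW = (-1,1)`
times a sign; the reversal is the Literature involution `srev`), the direction table entering only the last two
lemmas.

Proof (path counting).
* Total mass: `maskTail ≤ ∑_{D ⊆ V} ρ^|D| (1-ρ)^{|V|-|D|} = 1` (`maskTail_le_one`), which settles `r = 0` and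
  `7ρ ≥ 1`.
* `r ≥ 1`, `7ρ < 1`: a king path in `D` from `f` to a face at sup-distance `≥ r` has `≥ r` steps (each king step
  moves sup-distance by `≤ 1`, `supDist_le_length`); its first `r` steps form a self-avoiding, hence
  NON-BACKTRACKING, king walk from `f` with `r + 1` distinct vertices in `D` (`exists_nbw_of_event`), so the
  covering walks are indexed by the non-backtracking words `nbwWords 4 r`, of which there are `≤ 8 · 7^{r-1}`
  (`card_nbwWords_le`).  For a fixed walk the mask must contain its `r + 1` vertices, an event of probability
  `≤ ρ^{r+1}` (`sum_supset_eq`, via `Finset.prod_add`; `sum_traj_le`).  Hence (`maskTail_le_card_mul_pow`)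
  `maskTail ≤ 8 · 7^{r-1} ρ^{r+1} = (8ρ/7) (7ρ)^r ≤ (7ρ)^r`.
-/

noncomputable section

namespace Summit.CriticalPhenomena.CardyFormulaZ2.Cruxes.IKMixedBoxCrossing.DefectClosureExploration

open scoped BigOperators Classical
open Literature.Probability.Percolation Literature.Probability.LatticeModels

/-! ## Bernoulli weights: total mass and the marginal of a fixed set -/

/-- Total mass of the Bernoulli(`ρ`) weights bounds `maskTail` by `1`. -/
theorem maskTail_le_one {ρ : ℝ} (hρ0 : 0 ≤ ρ) (hρ1 : ρ ≤ 1) (V : Finset (Site 2)) (f : Site 2) (r : ℕ) :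
    maskTail ρ V f r ≤ 1 := by
  unfold maskTail
  calc _ ≤ ∑ D ∈ V.powerset, ρ ^ D.card * (1 - ρ) ^ (V.card - D.card) :=
        Finset.sum_le_sum fun D _ => by
          split_ifs
          · exact le_rfl
          · exact mul_nonneg (pow_nonneg hρ0 _) (pow_nonneg (by linarith) _)
    _ = 1 := by rw [Finset.sum_pow_mul_eq_add_pow, add_sub_cancel, one_pow]

/-- MARGINAL IDENTITY: under the Bernoulli(`ρ`) product weights on `V`, the mask contains a fixed `T ⊆ V` with
probability `ρ^|T|`. -/
theorem sum_supset_eq (ρ : ℝ) {T V : Finset (Site 2)} (hTV : T ⊆ V) :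
    ∑ D ∈ V.powerset, (if T ⊆ D then ρ ^ D.card * (1 - ρ) ^ (V.card - D.card) else 0) = ρ ^ T.card := by
  have key := Finset.prod_add (fun _ => ρ) (fun i => if i ∈ T then (0 : ℝ) else 1 - ρ) V
  have lhs : ∏ i ∈ V, (ρ + if i ∈ T then (0 : ℝ) else 1 - ρ) = ρ ^ T.card := by
    rw [Finset.prod_congr rfl (g := fun i => if i ∈ T then ρ else 1) (fun i _ => by split_ifs <;> ring),
      Finset.prod_ite_mem, Finset.inter_eq_right.mpr hTV, Finset.prod_const]
  rw [← lhs, key]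
  refine Finset.sum_congr rfl fun D hD => ?_
  have hDV : D ⊆ V := Finset.mem_powerset.mp hD
  rw [Finset.prod_const]
  by_cases hTD : T ⊆ D
  · rw [if_pos hTD, Finset.prod_congr rfl (g := fun _ => 1 - ρ)
        (fun i hi => if_neg fun hiT => (Finset.mem_sdiff.mp hi).2 (hTD hiT)),
      Finset.prod_const, Finset.card_sdiff_of_subset hDV]
  · obtain ⟨i, hiT, hiD⟩ := Finset.not_subset.mp hTD
    have hz : ∏ j ∈ V \ D, (if j ∈ T then (0 : ℝ) else 1 - ρ) = 0 :=
      Finset.prod_eq_zero (Finset.mem_sdiff.mpr ⟨hTV hiT, hiD⟩) (by rw [if_pos hiT])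
    rw [if_neg hTD, hz, mul_zero]

/-- The marginal bound for an arbitrary fixed set `T` (zero unless `T ⊆ V`). -/
theorem sum_supset_le {ρ : ℝ} (hρ0 : 0 ≤ ρ) (V T : Finset (Site 2)) :
    ∑ D ∈ V.powerset, (if T ⊆ D then ρ ^ D.card * (1 - ρ) ^ (V.card - D.card) else 0) ≤ ρ ^ T.card := by
  by_cases hTV : T ⊆ V
  · exact (sum_supset_eq ρ hTV).le
  · calc _ = ∑ D ∈ V.powerset, (0 : ℝ) :=
          Finset.sum_congr rfl fun D hD => if_neg fun hTD => hTV (hTD.trans (Finset.mem_powerset.mp hD))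
      _ ≤ ρ ^ T.card := by rw [Finset.sum_const_zero]; exact pow_nonneg hρ0 _

/-- For a fixed trajectory `P`, the weight of the masks containing its first `m + 1` points, these being distinct,
is `≤ ρ^{m+1}`. -/
theorem sum_traj_le {ρ : ℝ} (hρ0 : 0 ≤ ρ) (V : Finset (Site 2)) (m : ℕ) (P : ℕ → Site 2) :
    ∑ D ∈ V.powerset,
      (if Set.InjOn P ↑(Finset.range (m + 1)) ∧ (Finset.range (m + 1)).image P ⊆ D
        then ρ ^ D.card * (1 - ρ) ^ (V.card - D.card) else 0) ≤ ρ ^ (m + 1) := by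
  by_cases hinj : Set.InjOn P ↑(Finset.range (m + 1))
  · have hcard : ((Finset.range (m + 1)).image P).card = m + 1 := by
      rw [Finset.card_image_of_injOn hinj, Finset.card_range]
    calc _ = ∑ D ∈ V.powerset, (if (Finset.range (m + 1)).image P ⊆ D
              then ρ ^ D.card * (1 - ρ) ^ (V.card - D.card) else 0) :=
          Finset.sum_congr rfl fun D _ => by
            by_cases hsub : (Finset.range (m + 1)).image P ⊆ D
            · rw [if_pos ⟨hinj, hsub⟩, if_pos hsub]
            · rw [if_neg fun h => hsub h.2, if_neg hsub]
      _ ≤ ρ ^ ((Finset.range (m + 1)).image P).card := sum_supset_le hρ0 V _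
      _ = ρ ^ (m + 1) := by rw [hcard]
  · calc _ = ∑ D ∈ V.powerset, (0 : ℝ) := Finset.sum_congr rfl fun D _ => if_neg fun h => hinj h.1
      _ ≤ ρ ^ (m + 1) := by rw [Finset.sum_const_zero]; exact pow_nonneg hρ0 _

/-- UNION BOUND. If every mask whose polymer at `f` reaches sup-distance `≥ m` contains the first `m + 1` points,
these being distinct, of one of the trajectories `P i`, `i ∈ W`, then `maskTail ≤ |W| ρ^{m+1}`. -/
theorem maskTail_le_card_mul_pow {ρ : ℝ} (hρ0 : 0 ≤ ρ) (hρ1 : ρ ≤ 1) (V : Finset (Site 2)) (f : Site 2) (m : ℕ)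
    {ι : Type*} (W : Finset ι) (P : ι → ℕ → Site 2)
    (hcover : ∀ D : Finset (Site 2), (∃ g : Site 2, KingLinked D f g ∧ (m : ℤ) ≤ max |g 0 - f 0| |g 1 - f 1|) →
      ∃ i ∈ W, Set.InjOn (P i) ↑(Finset.range (m + 1)) ∧ (Finset.range (m + 1)).image (P i) ⊆ D) :
    maskTail ρ V f m ≤ W.card * ρ ^ (m + 1) := by
  calc maskTail ρ V f m
      ≤ ∑ i ∈ W, ∑ D ∈ V.powerset,
          (if Set.InjOn (P i) ↑(Finset.range (m + 1)) ∧ (Finset.range (m + 1)).image (P i) ⊆ D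
            then ρ ^ D.card * (1 - ρ) ^ (V.card - D.card) else 0) := by
        rw [Finset.sum_comm]
        unfold maskTail
        refine Finset.sum_le_sum fun D _ => ?_
        have hw0 : 0 ≤ ρ ^ D.card * (1 - ρ) ^ (V.card - D.card) :=
          mul_nonneg (pow_nonneg hρ0 _) (pow_nonneg (by linarith) _)
        have hnn : ∀ i ∈ W, (0 : ℝ) ≤
            (if Set.InjOn (P i) ↑(Finset.range (m + 1)) ∧ (Finset.range (m + 1)).image (P i) ⊆ D
              then ρ ^ D.card * (1 - ρ) ^ (V.card - D.card) else 0) := fun i _ => by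
          split_ifs
          · exact hw0
          · exact le_rfl
        split_ifs with hE
        · obtain ⟨i, hi, hinj, hsub⟩ := hcover D hE
          refine le_trans (le_of_eq ?_) (Finset.single_le_sum hnn hi)
          rw [if_pos ⟨hinj, hsub⟩]
        · exact Finset.sum_nonneg hnn
    _ ≤ ∑ _i ∈ W, ρ ^ (m + 1) := Finset.sum_le_sum fun i _ => sum_traj_le hρ0 V m (P i)
    _ = W.card * ρ ^ (m + 1) := by rw [Finset.sum_const, nsmul_eq_mul]

/-! ## King walks coded by the words of `nbwWords 4 m` -/

/-- A king step changes each coordinate by at most one: along any walk of an induced king graph the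
sup-distance between the endpoints is at most the length. -/
theorem supDist_le_length {S : Set (Site 2)} {x y : S} (p : (kingGraph.induce S).Walk x y) :
    max |(y : Site 2) 0 - (x : Site 2) 0| |(y : Site 2) 1 - (x : Site 2) 1| ≤ (p.length : ℤ) := by
  induction p with
  | nil => simp
  | @cons u v w h p ih =>
    have h' : kingGraph.Adj (u : Site 2) (v : Site 2) := SimpleGraph.induce_adj.mp h
    rw [kingGraph, SimpleGraph.fromRel_adj] at h'
    obtain ⟨-, h'⟩ := h'
    have h0 : |(v : Site 2) 0 - (u : Site 2) 0| ≤ 1 := by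
      rcases h' with h' | h'
      · rw [abs_sub_comm]; exact h'.1
      · exact h'.1
    have h1 : |(v : Site 2) 1 - (u : Site 2) 1| ≤ 1 := by
      rcases h' with h' | h'
      · rw [abs_sub_comm]; exact h'.2
      · exact h'.2
    have e0 := abs_sub_le ((w : Site 2) 0) ((v : Site 2) 0) ((u : Site 2) 0)
    have e1 := abs_sub_le ((w : Site 2) 1) ((v : Site 2) 1) ((u : Site 2) 1)
    rw [SimpleGraph.Walk.length_cons, Nat.cast_succ]
    rw [max_le_iff] at ih ⊢
    constructor <;> linarith [ih.1, ih.2]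

/-- COVERING. Let `base : Fin 4 → Site 2` be a direction table such that every king step is `± base i`. If the
mask polymer of `f` in `D` reaches sup-distance `≥ m`, then some non-backtracking word `w` of length `m` codes a
king walk `k ↦ f + ∑_{i<k} ± base (w i).1` from `f` whose first `m + 1` points are distinct and lie in `D` (the
first `m` steps of a king PATH from `f` to the far face; a backtracking word would repeat a point). -/
theorem exists_nbw_of_event (base : Fin 4 → Site 2)
    (hsurj : ∀ a b : Site 2, kingGraph.Adj a b → ∃ s : Fin 4 × Bool, b = a + (if s.2 then (1 : ℤ) else -1) • base s.1)
    {D : Finset (Site 2)} {f : Site 2} {m : ℕ}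
    (hE : ∃ g : Site 2, KingLinked D f g ∧ (m : ℤ) ≤ max |g 0 - f 0| |g 1 - f 1|) :
    ∃ w ∈ nbwWords 4 m,
      Set.InjOn (fun k => f + ∑ i ∈ Finset.range k,
          if h : i < m then (if (w ⟨i, h⟩).2 then (1 : ℤ) else -1) • base (w ⟨i, h⟩).1 else 0)
        ↑(Finset.range (m + 1)) ∧
      (Finset.range (m + 1)).image (fun k => f + ∑ i ∈ Finset.range k,
          if h : i < m then (if (w ⟨i, h⟩).2 then (1 : ℤ) else -1) • base (w ⟨i, h⟩).1 else 0) ⊆ D := by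
  obtain ⟨g, ⟨hf, hg, ⟨p⟩⟩, hdist⟩ := hE
  set q := p.bypass
  have hq : q.IsPath := p.bypass_isPath
  have hlen : m ≤ q.length := by
    have := hdist.trans (supDist_le_length q)
    exact_mod_cast this
  have hadj : ∀ i : Fin m, kingGraph.Adj (q.getVert i : Site 2) (q.getVert (i + 1) : Site 2) := fun i =>
    SimpleGraph.induce_adj.mp (q.adj_getVert_succ (lt_of_lt_of_le i.2 hlen))
  choose w hw using fun i : Fin m => hsurj _ _ (hadj i)
  set P : ℕ → Site 2 := fun k => f + ∑ i ∈ Finset.range k,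
      if h : i < m then (if (w ⟨i, h⟩).2 then (1 : ℤ) else -1) • base (w ⟨i, h⟩).1 else 0 with hP
  have hP0 : P 0 = f := by simp [hP]
  have hPs : ∀ k (hk : k < m), P (k + 1) = P k + (if (w ⟨k, hk⟩).2 then (1 : ℤ) else -1) • base (w ⟨k, hk⟩).1 := by
    intro k hk
    simp only [hP]
    rw [Finset.sum_range_succ, dif_pos hk, add_assoc]
  have hpos : ∀ i, i ≤ m → P i = (q.getVert i : Site 2) := by
    intro i
    induction i with
    | zero => intro _; rw [hP0, SimpleGraph.Walk.getVert_zero]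
    | succ i ih => intro hi; rw [hPs i (by omega), ih (by omega), hw ⟨i, by omega⟩]
  have hinj : Set.InjOn P ↑(Finset.range (m + 1)) := by
    intro i hi j hj hij
    rw [Finset.coe_range, Set.mem_Iio] at hi hj
    rw [hpos i (by omega), hpos j (by omega)] at hij
    exact hq.getVert_injOn (by simp only [Set.mem_setOf_eq]; omega) (by simp only [Set.mem_setOf_eq]; omega)
      (Subtype.ext hij)
  have hsv : ∀ x : Fin 4 × Bool, (if (srev x).2 then (1 : ℤ) else -1) • base (srev x).1 =
      -((if x.2 then (1 : ℤ) else -1) • base x.1) := by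
    rintro ⟨i, b⟩
    cases b <;> simp [srev]
  refine ⟨w, mem_nbwWords.2 fun k hk heq => ?_, hinj, fun x hx => ?_⟩
  · have h2 : P (k + 1 + 1) = P k := by
      rw [hPs _ hk, hPs k (by omega), heq, hsv, add_neg_cancel_right]
    have := hinj (by simp only [Finset.coe_range, Set.mem_Iio]; omega)
      (by simp only [Finset.coe_range, Set.mem_Iio]; omega) h2
    omega
  · rw [Finset.mem_image] at hx
    obtain ⟨i, hi, rfl⟩ := hx
    change P i ∈ D
    rw [hpos i (by simpa [Nat.lt_succ_iff] using hi)]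
    exact (q.getVert i).2

/-- THE DIRECTION TABLE `E = (1,0)`, `NE = (1,1)`, `N = (0,1)`, `NW = (-1,1)`: every king adjacency `a ~ b` is a
signed table step, `b = a ± baseᵢ`. -/
theorem exists_kingCode_of_adj (a b : Site 2) (h : kingGraph.Adj a b) :
    ∃ s : Fin 4 × Bool,
      b = a + (if s.2 then (1 : ℤ) else -1) • (![![1, 0], ![1, 1], ![0, 1], ![-1, 1]] : Fin 4 → Site 2) s.1 := by
  rw [kingGraph, SimpleGraph.fromRel_adj] at h
  obtain ⟨hne, h'⟩ := h
  have h0 : |b 0 - a 0| ≤ 1 := by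
    rcases h' with h' | h'
    · rw [abs_sub_comm]; exact h'.1
    · exact h'.1
  have h1 : |b 1 - a 1| ≤ 1 := by
    rcases h' with h' | h'
    · rw [abs_sub_comm]; exact h'.2
    · exact h'.2
  rw [abs_le] at h0 h1
  -- a displacement with the right two coordinates is the step
  have key : ∀ v : Site 2, v 0 = b 0 - a 0 → v 1 = b 1 - a 1 → b = a + v := by
    intro v e0 e1
    ext i
    fin_cases i <;> simp <;> omega
  rcases (show b 0 - a 0 = -1 ∨ b 0 - a 0 = 0 ∨ b 0 - a 0 = 1 by omega) with e0 | e0 | e0 <;>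
    rcases (show b 1 - a 1 = -1 ∨ b 1 - a 1 = 0 ∨ b 1 - a 1 = 1 by omega) with e1 | e1 | e1
  · exact ⟨(1, false), key _ (by rw [e0]; simp) (by rw [e1]; simp)⟩
  · exact ⟨(0, false), key _ (by rw [e0]; simp) (by rw [e1]; simp)⟩
  · exact ⟨(3, true), key _ (by rw [e0]; simp) (by rw [e1]; simp)⟩
  · exact ⟨(2, false), key _ (by rw [e0]; simp) (by rw [e1]; simp)⟩
  · exact absurd (funext fun i => by fin_cases i <;> simp <;> omega) hne
  · exact ⟨(2, true), key _ (by rw [e0]; simp) (by rw [e1]; simp)⟩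
  · exact ⟨(3, false), key _ (by rw [e0]; simp) (by rw [e1]; simp)⟩
  · exact ⟨(0, true), key _ (by rw [e0]; simp) (by rw [e1]; simp)⟩
  · exact ⟨(1, true), key _ (by rw [e0]; simp) (by rw [e1]; simp)⟩

/-! ## The path-counting bound -/

/-- The bound for `r = n + 1 ≥ 1` in the regime `8ρ ≤ 7`: `maskTail ≤ 8 · 7^n ρ^{n+2} ≤ (7ρ)^{n+1}`. -/
theorem maskTail_succ_le {ρ : ℝ} (hρ0 : 0 ≤ ρ) (hρ1 : ρ ≤ 1) (h87 : 8 * ρ ≤ 7) (V : Finset (Site 2)) (f : Site 2)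
    (n : ℕ) : maskTail ρ V f (n + 1) ≤ (7 * ρ) ^ (n + 1) := by
  have hC : ((nbwWords 4 (n + 1)).card : ℝ) ≤ 8 * 7 ^ n := by
    have := card_nbwWords_le 4 (show 1 ≤ n + 1 by omega)
    norm_num at this
    exact_mod_cast this
  have hA := maskTail_le_card_mul_pow hρ0 hρ1 V f (n + 1) (nbwWords 4 (n + 1)) _ fun D hE =>
    exists_nbw_of_event (![![1, 0], ![1, 1], ![0, 1], ![-1, 1]] : Fin 4 → Site 2) exists_kingCode_of_adj hE
  calc maskTail ρ V f (n + 1) ≤ (nbwWords 4 (n + 1)).card * ρ ^ (n + 1 + 1) := hA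
    _ ≤ 8 * 7 ^ n * ρ ^ (n + 1 + 1) := by gcongr
    _ = (8 * ρ) * (7 ^ n * ρ ^ (n + 1)) := by ring
    _ ≤ 7 * (7 ^ n * ρ ^ (n + 1)) := by gcongr
    _ = (7 * ρ) ^ (n + 1) := by ring

/-- **STUB `stub_polymerTail`** (registered stub of the line `defect-closure-exploration`): mask polymers are
subcritical, `maskTail ρ V f r ≤ (7ρ)^r` for `0 ≤ ρ ≤ 1` — a polymer reaching sup-distance `r` contains a
non-backtracking king walk of `r` steps from `f` with `r + 1` distinct masked faces, `≤ 8·7^{r-1} ρ^{r+1} ≤ (7ρ)^r`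
of them in expectation (and the total mass `1` handles `r = 0` and `7ρ ≥ 1`). -/
theorem stub_polymerTail : PolymerTail := by
  intro ρ hρ0 hρ1 V f r
  by_cases h7 : 1 ≤ 7 * ρ
  · exact (maskTail_le_one hρ0 hρ1 V f r).trans (one_le_pow₀ h7)
  · have h87 : 8 * ρ ≤ 7 := by linarith
    cases r with
    | zero => rw [pow_zero]; exact maskTail_le_one hρ0 hρ1 V f 0
    | succ n => exact maskTail_succ_le hρ0 hρ1 h87 V f n

end Summit.CriticalPhenomena.CardyFormulaZ2.Cruxes.IKMixedBoxCrossing.DefectClosureExploration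

end
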